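import Mathlib
import HarnessLib
import Literature.MathematicalPhysics.QuantumManyBody.BoseGasFreeDirichletBEC
import Literature.MathematicalPhysics.QuantumManyBody.BoseGasDirichletWall
import Summits.AtomisticToContinuum.BoseEinsteinCondensation.Theorems.ScaleConvexityFractionCalculus

/-!
# Route HealingPivotCascade — engine core (route-independent): the dyadic coherent sum `S_k` and the abstract cascade

decomp-a2c lens-6 g9; support for item `CascadeEngine` (stmt-AtomisticToContinuum-32061).  The one-body objects `IsModeOn` / `mass`
and the slice lemmas are those of `ScaleConvexityFractionCalculus` (one definition per concept; gate dedup): the level-`k` dyadic COHERENT SUM `subSum N L k Ψ = Σ_q ⟨u_q, γ_Ψ u_q⟩` over the `8^k`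
sub-cell indicator modes with `S_k ≤ N` (sub-cell Bessel) and `S_0 ≤ λ_max`; and the ABSTRACT REAL CASCADE
`cascade_abstract` (levels within `i₀` of either end take cap steps, the middle spends a budget `≤ 1/2`) with the
TWO-SIDED geometric budget `two_sided_budget_le`.  [elementary; objects LSSY2005 §1.2]
-/

noncomputable section

namespace Summit.AtomisticToContinuum.BoseEinsteinCondensation.Theorems.HealingPivotCascadeEngineCore

open scoped BigOperators Topology MeasureTheory ComplexConjugate ENNReal NNReal
open Filter Set MeasureTheory
open Summit.AtomisticToContinuum.BoseEinsteinCondensation.Theorems.ScaleConvexityFractionCalculus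

section Currency
open Literature.MathematicalPhysics.QuantumManyBody.BoseGas

/-- THE CURRENCY: the level-`k` dyadic coherent sum `S_k = Σ_q ⟨u_q, γ_Ψ u_q⟩` over the `8^k` sub-cell modes. -/
def subSum (N : ℕ) (L : ℝ) (k : ℕ) (Ψ : Config N → ℂ) : ENNReal :=
  ∑ q : SubIdx (2 ^ k), occupation N (subMode (L / 2 ^ k) q) Ψ

variable {n : ℕ}

/-- The normalised sub-cell indicator mode is a mode ON its sub-cell. -/
theorem subMode_isModeOn {ℓ : ℝ} (hℓ : 0 < ℓ) {k : ℕ} (q : SubIdx k) : IsModeOn (subCell ℓ q) (subMode ℓ q) := by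
  refine ⟨aestronglyMeasurable_subMode ℓ q, lintegral_subMode_sq hℓ q, fun x hx => ?_⟩
  rw [subMode_eq_indicator, Set.indicator_of_notMem hx]

/-- The open box of side `L` lies in the half-open cell of side `kℓ ≥ L`. -/
theorem box_subset_cell {L ℓ : ℝ} {k : ℕ} (hLk : L ≤ k * ℓ) : box L ⊆ cell (k * ℓ) := by
  intro x hx i
  have h := hx i
  exact ⟨h.1.le, lt_of_lt_of_le h.2 hLk⟩

/-- Tile masses add up to `N`. -/
theorem sum_mass_eq {L ℓ : ℝ} {k : ℕ} (hℓ : 0 < ℓ) (hLk : L ≤ k * ℓ) (Ψ : TrialState (n + 1) L) :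
    ∑ q : SubIdx k, mass (n + 1) (subCell ℓ q) Ψ.ψ = (n + 1 : ℝ≥0∞) := by
  have hΨ : Measurable Ψ.ψ := Ψ.contDiff.continuous.measurable
  have hρm : Measurable (oneParticleDensity (n + 1) Ψ.ψ) := by
    have : oneParticleDensity (n + 1) Ψ.ψ = fun x => (n + 1 : ℝ≥0∞) * sliceMass Ψ.ψ x := by
      funext x; simp [oneParticleDensity]
    rw [this]
    exact measurable_const.mul (measurable_sliceMass hΨ)
  simp only [mass]
  rw [sum_setLIntegral_subCell hℓ hρm.aemeasurable, setLIntegral_eq_of_support_subset,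
    lintegral_oneParticleDensity hΨ, Ψ.norm_eq, mul_one]
  intro x hx
  by_contra h
  exact hx (oneParticleDensity_eq_zero Ψ fun hb => h (box_subset_cell hLk hb))

/-- **`S_k ≤ N`** (sub-cell Bessel inequality). -/
theorem subSum_le_card {N : ℕ} {L : ℝ} (hL : 0 < L) (k : ℕ) (Ψ : TrialState N L) :
    subSum N L k Ψ.ψ ≤ (N : ENNReal) := by
  cases N with
  | zero => simp [subSum, occupation]
  | succ n =>
    have hℓ : 0 < L / 2 ^ k := by positivity
    have hLk : L ≤ ((2 ^ k : ℕ) : ℝ) * (L / 2 ^ k) := by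
      rw [Nat.cast_pow, Nat.cast_two, mul_div_cancel₀ L (by positivity)]
    have hΨ : Measurable Ψ.ψ := Ψ.contDiff.continuous.measurable
    calc subSum (n + 1) L k Ψ.ψ
        ≤ ∑ q : SubIdx (2 ^ k), mass (n + 1) (subCell (L / 2 ^ k) q) Ψ.ψ :=
          Finset.sum_le_sum fun q _ =>
            occupation_le_mass (measurableSet_subCell _ q) hΨ (subMode_isModeOn hℓ q)
      _ = (n + 1 : ℝ≥0∞) := sum_mass_eq hℓ hLk Ψ
      _ = ((n + 1 : ℕ) : ENNReal) := by push_cast; rfl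

/-- `S_k` is finite. -/
theorem subSum_ne_top {N : ℕ} {L : ℝ} (hL : 0 < L) (k : ℕ) (Ψ : TrialState N L) : subSum N L k Ψ.ψ ≠ ⊤ :=
  ne_top_of_le_ne_top (ENNReal.natCast_ne_top N) (subSum_le_card hL k Ψ)

/-- **Level 0**: the single sub-cell mode of `[0,L)³` is a test mode for `λ_max`, so `S_0 ≤ λ_max`. -/
theorem subSum_zero_le_maxOccupation {N : ℕ} {L : ℝ} (hL : 0 < L) (Ψ : Config N → ℂ) :
    subSum N L 0 Ψ ≤ maxOccupation N Ψ := by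
  have hℓ : 0 < L / 2 ^ 0 := by positivity
  calc subSum N L 0 Ψ ≤ ∑ _q : SubIdx (2 ^ 0), maxOccupation N Ψ :=
        Finset.sum_le_sum fun q _ =>
          occupation_le_maxOccupation Ψ (aestronglyMeasurable_subMode _ q) (lintegral_subMode_sq hℓ q)
    _ = maxOccupation N Ψ := by
        rw [Finset.sum_const, Finset.card_univ]
        have : Fintype.card (SubIdx (2 ^ 0)) = 1 := by simp [SubIdx]
        rw [this, one_smul]

end Currency

section RealCascade

/-- **Abstract real cascade.** Levels `K, K-1, …, 0`; at a GOOD level the step loses at most the relative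
amount `d k` (total good budget `≤ 1/2`), at each of the at most `n` other levels the CAP (relative loss `≤ x`)
applies as long as the level is above the threshold `θ`; then `a 0 ≥ f (1-x)^n / 2`. -/
theorem cascade_abstract {K n : ℕ} {x θ f : ℝ} (a d : ℕ → ℝ) (good : ℕ → Prop) [DecidablePred good]
    (hx0 : 0 ≤ x) (hx1 : x < 1) (hf : 0 ≤ f) (hK : f ≤ a K) (hd : ∀ k, 0 ≤ d k)
    (hsum : ∑ k ∈ (Finset.Ioc 0 K).filter good, d k ≤ 1 / 2)
    (hbad : ((Finset.Ioc 0 K).filter (fun k => ¬ good k)).card ≤ n)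
    (hθ : θ ≤ f * (1 - x) ^ n / 2)
    (hdom : ∀ k, 1 ≤ k → k ≤ K → good k → (1 - d k) * a k ≤ a (k - 1))
    (hcap : ∀ k, 1 ≤ k → k ≤ K → θ ≤ a k → (1 - x) * a k ≤ a (k - 1)) :
    f * (1 - x) ^ n / 2 ≤ a 0 := by
  have hx' : (0 : ℝ) ≤ 1 - x := by linarith
  have hx'1 : 1 - x ≤ 1 := by linarith
  -- suffix intervals `(K-j, K]`, their bad count and their good budget
  set I : ℕ → Finset ℕ := fun j => Finset.Ioc (K - j) K with hI
  set b : ℕ → ℕ := fun j => ((I j).filter (fun k => ¬ good k)).card with hb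
  set s : ℕ → ℝ := fun j => ∑ k ∈ (I j).filter good, d k with hs
  have hIsub : ∀ j, I j ⊆ Finset.Ioc 0 K := fun j => Finset.Ioc_subset_Ioc_left (Nat.zero_le _)
  have hb_le : ∀ j, b j ≤ n := fun j =>
    (Finset.card_le_card (Finset.filter_subset_filter _ (hIsub j))).trans hbad
  have hs_le : ∀ j, s j ≤ 1 / 2 := fun j =>
    (Finset.sum_le_sum_of_subset_of_nonneg (Finset.filter_subset_filter _ (hIsub j))
      (fun k _ _ => hd k)).trans hsum
  have hs_nn : ∀ j, 0 ≤ s j := fun j => Finset.sum_nonneg fun k _ => hd k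
  -- the running lower bound dominates the final constant
  have hlow : ∀ j, f * (1 - x) ^ n / 2 ≤ f * (1 - x) ^ (b j) * (1 - s j) := by
    intro j
    have h1 : (1 - x) ^ n ≤ (1 - x) ^ (b j) := pow_le_pow_of_le_one hx' hx'1 (hb_le j)
    have h2 : 1 / 2 ≤ 1 - s j := by linarith [hs_le j]
    calc f * (1 - x) ^ n / 2 = f * (1 - x) ^ n * (1 / 2) := by ring
      _ ≤ f * (1 - x) ^ (b j) * (1 - s j) := by gcongr
  have hstepI : ∀ j, j + 1 ≤ K → I (j + 1) = insert (K - j) (I j) := by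
    intro j hj
    ext i
    simp only [hI, Finset.mem_insert, Finset.mem_Ioc]
    omega
  have hnot : ∀ j, K - j ∉ I j := by
    intro j
    simp only [hI, Finset.mem_Ioc]
    omega
  -- induction down the levels
  have key : ∀ j, j ≤ K → f * (1 - x) ^ (b j) * (1 - s j) ≤ a (K - j) := by
    intro j
    induction j with
    | zero =>
      intro _
      have hI0 : I 0 = ∅ := by simp [hI]
      have hb0 : b 0 = 0 := by simp [hb, hI0]
      have hs0 : s 0 = 0 := by simp [hs, hI0]
      rw [hb0, hs0, Nat.sub_zero]
      simpa using hK
    | succ j ih =>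
      intro hj
      have ihj := ih (Nat.le_of_succ_le hj)
      have hk1 : 1 ≤ K - j := by omega
      have hkK : K - j ≤ K := Nat.sub_le _ _
      have hidx : K - j - 1 = K - (j + 1) := by omega
      have hIj := hstepI j hj
      have hnj := hnot j
      have hpos : 0 ≤ f * (1 - x) ^ (b j) := by positivity
      by_cases hg : good (K - j)
      · -- good step: spend `d (K-j)` of the budget
        have hbj : b (j + 1) = b j := by
          simp only [hb, hIj, Finset.filter_insert, hg, not_true_eq_false, if_false]
        have hsj : s (j + 1) = s j + d (K - j) := by
          have hnj' : K - j ∉ (I j).filter good := fun h => hnj (Finset.mem_of_mem_filter _ h)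
          simp only [hs, hIj, Finset.filter_insert, hg, if_true]
          rw [Finset.sum_insert hnj', add_comm]
        have hdk : d (K - j) ≤ 1 / 2 := by
          have hmem : K - j ∈ (Finset.Ioc 0 K).filter good := by
            simp only [Finset.mem_filter, Finset.mem_Ioc]
            exact ⟨⟨by omega, hkK⟩, hg⟩
          have : d (K - j) ≤ ∑ k ∈ (Finset.Ioc 0 K).filter good, d k :=
            Finset.single_le_sum (fun k _ => hd k) hmem
          linarith
        have hstep := hdom (K - j) hk1 hkK hg
        rw [hidx] at hstep
        calc f * (1 - x) ^ (b (j + 1)) * (1 - s (j + 1))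
            = f * (1 - x) ^ (b j) * (1 - s j - d (K - j)) := by rw [hbj, hsj]; ring
          _ ≤ f * (1 - x) ^ (b j) * ((1 - d (K - j)) * (1 - s j)) := by
              apply mul_le_mul_of_nonneg_left _ hpos
              nlinarith [hd (K - j), hs_nn j]
          _ = (1 - d (K - j)) * (f * (1 - x) ^ (b j) * (1 - s j)) := by ring
          _ ≤ (1 - d (K - j)) * a (K - j) := by
              apply mul_le_mul_of_nonneg_left ihj
              linarith
          _ ≤ a (K - (j + 1)) := hstep
      · -- capped step: the level is above the threshold by the running lower bound
        have hbj : b (j + 1) = b j + 1 := by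
          have hnj' : K - j ∉ (I j).filter (fun k => ¬ good k) := fun h => hnj (Finset.mem_of_mem_filter _ h)
          simp only [hb, hIj, Finset.filter_insert, hg, not_false_eq_true, if_true]
          rw [Finset.card_insert_of_notMem hnj']
        have hsj : s (j + 1) = s j := by
          simp only [hs, hIj, Finset.filter_insert, hg, if_false]
        have hθa : θ ≤ a (K - j) := (hθ.trans (hlow j)).trans ihj
        have hstep := hcap (K - j) hk1 hkK hθa
        rw [hidx] at hstep
        calc f * (1 - x) ^ (b (j + 1)) * (1 - s (j + 1))
            = (1 - x) * (f * (1 - x) ^ (b j) * (1 - s j)) := by rw [hbj, hsj]; ring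
          _ ≤ (1 - x) * a (K - j) := mul_le_mul_of_nonneg_left ihj hx'
          _ ≤ a (K - (j + 1)) := hstep
  have := key K le_rfl
  rw [Nat.sub_self] at this
  exact (hlow K).trans this

/-- The bad levels of the two-sided budget (`K - k < i₀` near the pivot or `k < i₀` near the box) are at
most `2 i₀` in number. -/
theorem bad_card_le (K i₀ : ℕ) :
    ((Finset.Ioc 0 K).filter (fun k => ¬ (i₀ ≤ K - k ∧ i₀ ≤ k))).card ≤ 2 * i₀ := by
  calc ((Finset.Ioc 0 K).filter (fun k => ¬ (i₀ ≤ K - k ∧ i₀ ≤ k))).card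
        ≤ (Finset.Ioc (K - i₀) K ∪ Finset.range i₀).card := by
          apply Finset.card_le_card
          intro k hk
          simp only [Finset.mem_filter, Finset.mem_Ioc] at hk
          simp only [Finset.mem_union, Finset.mem_Ioc, Finset.mem_range]
          omega
    _ ≤ (Finset.Ioc (K - i₀) K).card + (Finset.range i₀).card := Finset.card_union_le _ _
    _ ≤ 2 * i₀ := by simp only [Nat.card_Ioc, Finset.card_range]; omega

/-- Good-level budget, box side: `Σ_{good k} q^k ≤ q^{i₀}/(1-q)`. -/
theorem geom_good_le {q : ℝ} (hq0 : 0 ≤ q) (hq1 : q < 1) (K i₀ : ℕ) :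
    ∑ k ∈ (Finset.Ioc 0 K).filter (fun k => i₀ ≤ K - k ∧ i₀ ≤ k), q ^ k ≤ q ^ i₀ / (1 - q) := by
  calc ∑ k ∈ (Finset.Ioc 0 K).filter (fun k => i₀ ≤ K - k ∧ i₀ ≤ k), q ^ k
        ≤ ∑ k ∈ Finset.Ico i₀ (K + 1), q ^ k := by
          apply Finset.sum_le_sum_of_subset_of_nonneg
          · intro k hk
            simp only [Finset.mem_filter, Finset.mem_Ioc] at hk
            simp only [Finset.mem_Ico]
            omega
          · intro k _ _
            positivity
    _ ≤ q ^ i₀ / (1 - q) := geom_sum_Ico_le_of_lt_one hq0 hq1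

/-- Good-level budget, pivot side: `Σ_{good k} q^{K-k} ≤ q^{i₀}/(1-q)` (re-index `k ↦ K - k`). -/
theorem geom_good_reflect_le {q : ℝ} (hq0 : 0 ≤ q) (hq1 : q < 1) (K i₀ : ℕ) :
    ∑ k ∈ (Finset.Ioc 0 K).filter (fun k => i₀ ≤ K - k ∧ i₀ ≤ k), q ^ (K - k) ≤ q ^ i₀ / (1 - q) := by
  set F := (Finset.Ioc 0 K).filter (fun k => i₀ ≤ K - k ∧ i₀ ≤ k) with hF
  have hinj : Set.InjOn (fun k => K - k) (F : Set ℕ) := by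
    intro a ha b hb hab
    simp only [hF, Finset.coe_filter, Finset.mem_Ioc, Set.mem_setOf_eq] at ha hb
    simp only at hab
    omega
  have himg : ∑ m ∈ F.image (fun k => K - k), q ^ m = ∑ k ∈ F, q ^ (K - k) := Finset.sum_image hinj
  rw [← himg]
  calc ∑ m ∈ F.image (fun k => K - k), q ^ m ≤ ∑ m ∈ Finset.Ico i₀ (K + 1), q ^ m := by
          apply Finset.sum_le_sum_of_subset_of_nonneg
          · intro m hm
            simp only [hF, Finset.mem_image, Finset.mem_filter, Finset.mem_Ioc] at hm
            obtain ⟨k, ⟨⟨_, hkK⟩, hg1, _⟩, rfl⟩ := hm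
            simp only [Finset.mem_Ico]
            omega
          · intro m _ _
            positivity
    _ ≤ q ^ i₀ / (1 - q) := geom_sum_Ico_le_of_lt_one hq0 hq1

/-- The two-sided budget over the good levels is at most `1/2` once `A q^{i₀} ≤ (1-q)/4`. -/
theorem two_sided_budget_le {A q : ℝ} (hA : 0 ≤ A) (hq0 : 0 ≤ q) (hq1 : q < 1) {K i₀ : ℕ}
    (hi₀ : A * q ^ i₀ ≤ (1 - q) / 4) :
    ∑ k ∈ (Finset.Ioc 0 K).filter (fun k => i₀ ≤ K - k ∧ i₀ ≤ k), A * (q ^ (K - k) + q ^ k) ≤ 1 / 2 := by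
  have h1q : 0 < 1 - q := sub_pos.2 hq1
  rw [← Finset.mul_sum, Finset.sum_add_distrib]
  calc A * (∑ k ∈ (Finset.Ioc 0 K).filter (fun k => i₀ ≤ K - k ∧ i₀ ≤ k), q ^ (K - k) +
          ∑ k ∈ (Finset.Ioc 0 K).filter (fun k => i₀ ≤ K - k ∧ i₀ ≤ k), q ^ k)
        ≤ A * (q ^ i₀ / (1 - q) + q ^ i₀ / (1 - q)) := by
          gcongr
          · exact geom_good_reflect_le hq0 hq1 K i₀
          · exact geom_good_le hq0 hq1 K i₀
    _ = 2 * (A * q ^ i₀) / (1 - q) := by ring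
    _ ≤ 2 * ((1 - q) / 4) / (1 - q) := by gcongr
    _ = 1 / 2 := by field_simp; ring

end RealCascade

end Summit.AtomisticToContinuum.BoseEinsteinCondensation.Theorems.HealingPivotCascadeEngineCore

end
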